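import Summits.QuantumFields.YangMills.Theorems.BalabanLadderUVOtherGroupsDefs
import Summits.QuantumFields.YangMills.Theorems.BalabanUVNodesClustersLeaf
import Literature.MathematicalPhysics.QuantumFieldTheory.Balaban1983to89.Node00.Record12
import HarnessLib

/-!
# Route `BalabanLadder`, crux `UVOtherGroups` (stmt-QuantumFields-19356): `UVApexSUN` at Track A's θ-KEYED Stage-12 resolution (route revs 14–15)

Helper file (`--supports stmt-QuantumFields-19356`, fleet seat `ym-osasm-p2`, director-ym R136 (iii)); pure theorems.  Track A's detail route
`BalabanUVNodes` re-keyed its four cruxes at rev 14 (2026-08-26T20:01Z) to NODE 00's Stage-12 record in θ-KEYED form — items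
`Record12Inhabited` (stmt-QuantumFields-19789), `StabilityBAtRecordR12e` (19790), `EndpointGivenBR12` (19791), `SpineGivenEndpointR12` (19792), all over
`θ : Node00.Stage12Params F 2`, `h : θ.Provisos₁₂ F 2`, the datum `Node00.datumOfRecord₁₂ F 2 θ h` — and at rev 15 (20:35Z) threaded
`θ.SlotsNondegenerate` next to `θ.ZtUnity F 2` as ONE bundled conjunct; deciding theorem
`closes (h0 : Record12Inhabited) (h1 : StabilityBAtRecordR12e) (h2 : EndpointGivenBR12) (h3 : SpineGivenEndpointR12) : Theses.BalabanLadder.UV`.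
Every object in the four texts is typed at `SU(N)`, `[NeZero N]` (`Stage12Params F N`, `Provisos₁₂ F N`, `ZtUnity F N`, `SlotsNondegenerate`,
`Admissible F N`, `datumOfRecord₁₂ F N θ h`, `isDatumOfRecord₀_datumOfRecord₁₂ F N θ h : IsDatumOfRecord₀ F N _ := rfl`), so the same four statements
with `2 ↦ N` and Track A's own five-line proof give the `SU(N)` leaf `YMDAG.UVSplit.UVD59 N` for EVERY `N`:

* §1 `uvD59_of_thetaChain₁₂` — stated once over an ARBITRARY bundled θ-side conjunct `U F θ` sitting exactly where Track A puts
  `(θ.ZtUnity F 2 ∧ θ.SlotsNondegenerate)` (so the lemma survives further 1:1 restates that only re-thread that conjunct);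
  `record12C_inhabited_of_theta` — the θ-keyed inhabitation item implies the `(D, w)`-record inhabitation hypothesis `h0` of the sibling
  `uvD59_of_recordChain₁₂C` (`Theorems/BalabanLadderUVOtherGroupsRecord12.lean`, p464343), by def-T's `Node00.exists_world_isRecordOfRecord₁₂C`.
* §2 the rev-15 texts verbatim with `2 ↦ N`: `uvD59_of_theta15Chain` (every `N`), `uv_of_theta15Chain_two` (at `N = 2`: `Theses.BalabanLadder.UV`
  BY NAME via `YMDAG.UVSplit.uvD59_two_iff`; the four hypotheses are then LITERALLY the bodies of items 19789–19792 — checked by `exact` in the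
  seat's identity scratch, the detail route's file is not imported here), `uvApexSUN_of_theta15Chain` (`∀ N ≥ 3` = the R85 edit's `UVApexSUN`
  body), `uvSUN_of_theta15Chain` (`∀ N ≥ 2` = `UVSUN`).

Siblings: Stage-0 cut `uvD59_of_stage0Chain` (rev 11, p465045), Stage-11 record `uvD59_of_recordChain₁₁C` (p452338), Stage-12 `(D, w)` record
`uvD59_of_recordChain₁₂C` (p464343).  HONEST FRAMING: the four hypotheses are Bałaban's programme per `SU(N)` ([B4]–[B16]; the `N`-dependence of
every constant is unprinted); nothing is discharged; not a gap, not Clay.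
-/

set_option autoImplicit false

noncomputable section

open Literature.MathematicalPhysics.QuantumFieldTheory
open Literature.MathematicalPhysics.QuantumFieldTheory.Balaban1983to89
open Literature.MathematicalPhysics.QuantumFieldTheory.Balaban1983to89.T4Continuum

namespace Summit.QuantumFields.YangMills.Theorems.UVOtherGroups

/-! ## §1 The θ-keyed Stage-12 chain over an arbitrary bundled θ-side conjunct -/

section Theta12

variable {N : ℕ} [NeZero N] {U : ∀ F : T4Family, Node00.Stage12Params F N → Prop}

/-- **Track A's `closes` (revs 14–15) at `SU(N)`, θ-keyed Stage-12 record, arbitrary bundled θ-side conjunct `U`**: inhabitation of the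
admissible Stage-12 tuples with provisos and `U` · (B) + window at some such tuple's datum of record · END given (B) + window · hybrid-NE7 spine
given (B) + END ⟹ `YMDAG.UVSplit.UVD59 N`, for EVERY `N` — by the detail route's own proof (the datum of record IS a Stage-0 datum of record,
`Node00.isDatumOfRecord₀_datumOfRecord₁₂`, `rfl`). -/
theorem uvD59_of_thetaChain₁₂
    (h0 : ∀ F : T4Family, ∃ θ : Node00.Stage12Params F N, θ.Provisos₁₂ F N ∧ U F θ ∧ θ.Admissible F N)
    (h1 : ∀ F : T4Family, (∃ θ : Node00.Stage12Params F N, θ.Provisos₁₂ F N ∧ U F θ ∧ θ.Admissible F N) →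
      ∃ (θ : Node00.Stage12Params F N) (h : θ.Provisos₁₂ F N), U F θ ∧ θ.Admissible F N ∧
        B16.EndStatementBPrinted (Node00.datumOfRecord₁₂ F N θ h).C ∧ ∃ γ₁ : ℝ, 0 < γ₁ ∧ ∀ γ : ℝ, 0 < γ → γ ≤ γ₁ →
          ∃ P : B12.RunParams, 1 ≤ P.K ∧ ((Node00.datumOfRecord₁₂ F N θ h).C P).flow.InInterval γ P.K)
    (h2 : ∀ (F : T4Family) (θ : Node00.Stage12Params F N) (h : θ.Provisos₁₂ F N), U F θ → θ.Admissible F N →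
      B16.EndStatementBPrinted (Node00.datumOfRecord₁₂ F N θ h).C → (∃ γ₁ : ℝ, 0 < γ₁ ∧ ∀ γ : ℝ, 0 < γ → γ ≤ γ₁ →
        ∃ P : B12.RunParams, 1 ≤ P.K ∧ ((Node00.datumOfRecord₁₂ F N θ h).C P).flow.InInterval γ P.K) →
      DagBinding.EndpointExistence (Node00.datumOfRecord₁₂ F N θ h).C.toB12)
    (h3 : ∀ (F : T4Family) (θ : Node00.Stage12Params F N) (h : θ.Provisos₁₂ F N), U F θ → θ.Admissible F N →
      B16.EndStatementBPrinted (Node00.datumOfRecord₁₂ F N θ h).C → DagBinding.EndpointExistence (Node00.datumOfRecord₁₂ F N θ h).C.toB12 →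
      T4ApexHybrid.HybridNE7Under (Node00.datumOfRecord₁₂ F N θ h) (DagBinding.EndpointExistence (Node00.datumOfRecord₁₂ F N θ h).C.toB12)) :
    YMDAG.UVSplit.UVD59 N := by
  intro F
  obtain ⟨θ, h, hU, hθ, hb, hwin⟩ := h1 F (h0 F)
  have hend : DagBinding.EndpointExistence (Node00.datumOfRecord₁₂ F N θ h).C.toB12 := h2 F θ h hU hθ hb hwin
  exact ⟨Node00.datumOfRecord₁₂ F N θ h, Node00.isDatumOfRecord₀_datumOfRecord₁₂ F N θ h, hb, hend, h3 F θ h hU hθ hb hend⟩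

/-- **θ-keyed inhabitation ⇒ `(D, w)`-record inhabitation** (every `N`, any `U`): the θ-keyed item «some admissible Stage-12 tuple with provisos»
gives the inhabitation hypothesis `h0` of the `(D, w)`-record chain `uvD59_of_recordChain₁₂C` — every admissible tuple with provisos IS a
Stage-12 record at some world, window `γw := θ.γ > 0` (def-T `Node00.exists_world_isRecordOfRecord₁₂C`, `Stage9Params.Admissible.gamma_pos`). -/
theorem record12C_inhabited_of_theta
    (h0 : ∀ F : T4Family, ∃ θ : Node00.Stage12Params F N, θ.Provisos₁₂ F N ∧ U F θ ∧ θ.Admissible F N) (F : T4Family) :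
    ∃ (D : FiniteEpsData F (Matrix.specialUnitaryGroup (Fin N) ℂ)) (w : DagBinding.WorldP), Node00.IsRecordOfRecord₁₂C F N D w := by
  obtain ⟨θ, h, -, hθ⟩ := h0 F
  obtain ⟨w, hw, -⟩ := Node00.exists_world_isRecordOfRecord₁₂C F N θ h hθ ⟨hθ.toStage9.gamma_pos, le_rfl⟩
  exact ⟨_, w, hw⟩

end Theta12

/-! ## §2 The rev-15 texts verbatim, `2 ↦ N` -/

section Rev15

variable {N : ℕ} [NeZero N]

/-- **Track A's rev-15 chain at `SU(N)`** (bundled conjunct `U F θ := θ.ZtUnity F N ∧ θ.SlotsNondegenerate`): the four rev-15 item texts with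
`2 ↦ N` imply `YMDAG.UVSplit.UVD59 N`, every `N` (`uvD59_of_thetaChain₁₂`). -/
theorem uvD59_of_theta15Chain
    (h0 : ∀ F : T4Family, ∃ θ : Node00.Stage12Params F N, θ.Provisos₁₂ F N ∧ (θ.ZtUnity F N ∧ θ.SlotsNondegenerate) ∧ θ.Admissible F N)
    (h1 : ∀ F : T4Family, (∃ θ : Node00.Stage12Params F N, θ.Provisos₁₂ F N ∧ (θ.ZtUnity F N ∧ θ.SlotsNondegenerate) ∧ θ.Admissible F N) →
      ∃ (θ : Node00.Stage12Params F N) (h : θ.Provisos₁₂ F N), (θ.ZtUnity F N ∧ θ.SlotsNondegenerate) ∧ θ.Admissible F N ∧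
        B16.EndStatementBPrinted (Node00.datumOfRecord₁₂ F N θ h).C ∧ ∃ γ₁ : ℝ, 0 < γ₁ ∧ ∀ γ : ℝ, 0 < γ → γ ≤ γ₁ →
          ∃ P : B12.RunParams, 1 ≤ P.K ∧ ((Node00.datumOfRecord₁₂ F N θ h).C P).flow.InInterval γ P.K)
    (h2 : ∀ (F : T4Family) (θ : Node00.Stage12Params F N) (h : θ.Provisos₁₂ F N), (θ.ZtUnity F N ∧ θ.SlotsNondegenerate) → θ.Admissible F N →
      B16.EndStatementBPrinted (Node00.datumOfRecord₁₂ F N θ h).C → (∃ γ₁ : ℝ, 0 < γ₁ ∧ ∀ γ : ℝ, 0 < γ → γ ≤ γ₁ →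
        ∃ P : B12.RunParams, 1 ≤ P.K ∧ ((Node00.datumOfRecord₁₂ F N θ h).C P).flow.InInterval γ P.K) →
      DagBinding.EndpointExistence (Node00.datumOfRecord₁₂ F N θ h).C.toB12)
    (h3 : ∀ (F : T4Family) (θ : Node00.Stage12Params F N) (h : θ.Provisos₁₂ F N), (θ.ZtUnity F N ∧ θ.SlotsNondegenerate) → θ.Admissible F N →
      B16.EndStatementBPrinted (Node00.datumOfRecord₁₂ F N θ h).C → DagBinding.EndpointExistence (Node00.datumOfRecord₁₂ F N θ h).C.toB12 →
      T4ApexHybrid.HybridNE7Under (Node00.datumOfRecord₁₂ F N θ h) (DagBinding.EndpointExistence (Node00.datumOfRecord₁₂ F N θ h).C.toB12)) :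
    YMDAG.UVSplit.UVD59 N :=
  uvD59_of_thetaChain₁₂ (U := fun F θ => θ.ZtUnity F N ∧ θ.SlotsNondegenerate) h0 h1 h2 h3

end Rev15

/-- **At `N = 2` the rev-15 chain concludes the spine's leaf `Theses.BalabanLadder.UV` BY NAME** (`YMDAG.UVSplit.uvD59_two_iff`); the four
hypotheses are then verbatim the bodies of Track A's items `Record12Inhabited` ∕ `StabilityBAtRecordR12e` ∕ `EndpointGivenBR12` ∕
`SpineGivenEndpointR12` (rev 15). -/
theorem uv_of_theta15Chain_two
    (h0 : ∀ F : T4Family, ∃ θ : Node00.Stage12Params F 2, θ.Provisos₁₂ F 2 ∧ (θ.ZtUnity F 2 ∧ θ.SlotsNondegenerate) ∧ θ.Admissible F 2)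
    (h1 : ∀ F : T4Family, (∃ θ : Node00.Stage12Params F 2, θ.Provisos₁₂ F 2 ∧ (θ.ZtUnity F 2 ∧ θ.SlotsNondegenerate) ∧ θ.Admissible F 2) →
      ∃ (θ : Node00.Stage12Params F 2) (h : θ.Provisos₁₂ F 2), (θ.ZtUnity F 2 ∧ θ.SlotsNondegenerate) ∧ θ.Admissible F 2 ∧
        B16.EndStatementBPrinted (Node00.datumOfRecord₁₂ F 2 θ h).C ∧ ∃ γ₁ : ℝ, 0 < γ₁ ∧ ∀ γ : ℝ, 0 < γ → γ ≤ γ₁ →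
          ∃ P : B12.RunParams, 1 ≤ P.K ∧ ((Node00.datumOfRecord₁₂ F 2 θ h).C P).flow.InInterval γ P.K)
    (h2 : ∀ (F : T4Family) (θ : Node00.Stage12Params F 2) (h : θ.Provisos₁₂ F 2), (θ.ZtUnity F 2 ∧ θ.SlotsNondegenerate) → θ.Admissible F 2 →
      B16.EndStatementBPrinted (Node00.datumOfRecord₁₂ F 2 θ h).C → (∃ γ₁ : ℝ, 0 < γ₁ ∧ ∀ γ : ℝ, 0 < γ → γ ≤ γ₁ →
        ∃ P : B12.RunParams, 1 ≤ P.K ∧ ((Node00.datumOfRecord₁₂ F 2 θ h).C P).flow.InInterval γ P.K) →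
      DagBinding.EndpointExistence (Node00.datumOfRecord₁₂ F 2 θ h).C.toB12)
    (h3 : ∀ (F : T4Family) (θ : Node00.Stage12Params F 2) (h : θ.Provisos₁₂ F 2), (θ.ZtUnity F 2 ∧ θ.SlotsNondegenerate) → θ.Admissible F 2 →
      B16.EndStatementBPrinted (Node00.datumOfRecord₁₂ F 2 θ h).C → DagBinding.EndpointExistence (Node00.datumOfRecord₁₂ F 2 θ h).C.toB12 →
      T4ApexHybrid.HybridNE7Under (Node00.datumOfRecord₁₂ F 2 θ h) (DagBinding.EndpointExistence (Node00.datumOfRecord₁₂ F 2 θ h).C.toB12)) :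
    Summit.QuantumFields.YangMills.Theses.BalabanLadder.UV :=
  YMDAG.UVSplit.uvD59_two_iff.1 (uvD59_of_theta15Chain h0 h1 h2 h3)

/-- **The R85 piece `UVApexSUN` from the rev-15 chain for every `N ≥ 3`** (`∀ N ≥ 3, YMDAG.UVSplit.UVD59 N`). -/
theorem uvApexSUN_of_theta15Chain
    (h0 : ∀ (N : ℕ) [NeZero N], 3 ≤ N → ∀ F : T4Family,
      ∃ θ : Node00.Stage12Params F N, θ.Provisos₁₂ F N ∧ (θ.ZtUnity F N ∧ θ.SlotsNondegenerate) ∧ θ.Admissible F N)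
    (h1 : ∀ (N : ℕ) [NeZero N], 3 ≤ N → ∀ F : T4Family,
      (∃ θ : Node00.Stage12Params F N, θ.Provisos₁₂ F N ∧ (θ.ZtUnity F N ∧ θ.SlotsNondegenerate) ∧ θ.Admissible F N) →
      ∃ (θ : Node00.Stage12Params F N) (h : θ.Provisos₁₂ F N), (θ.ZtUnity F N ∧ θ.SlotsNondegenerate) ∧ θ.Admissible F N ∧
        B16.EndStatementBPrinted (Node00.datumOfRecord₁₂ F N θ h).C ∧ ∃ γ₁ : ℝ, 0 < γ₁ ∧ ∀ γ : ℝ, 0 < γ → γ ≤ γ₁ →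
          ∃ P : B12.RunParams, 1 ≤ P.K ∧ ((Node00.datumOfRecord₁₂ F N θ h).C P).flow.InInterval γ P.K)
    (h2 : ∀ (N : ℕ) [NeZero N], 3 ≤ N → ∀ (F : T4Family) (θ : Node00.Stage12Params F N) (h : θ.Provisos₁₂ F N),
      (θ.ZtUnity F N ∧ θ.SlotsNondegenerate) → θ.Admissible F N → B16.EndStatementBPrinted (Node00.datumOfRecord₁₂ F N θ h).C →
      (∃ γ₁ : ℝ, 0 < γ₁ ∧ ∀ γ : ℝ, 0 < γ → γ ≤ γ₁ →
        ∃ P : B12.RunParams, 1 ≤ P.K ∧ ((Node00.datumOfRecord₁₂ F N θ h).C P).flow.InInterval γ P.K) →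
      DagBinding.EndpointExistence (Node00.datumOfRecord₁₂ F N θ h).C.toB12)
    (h3 : ∀ (N : ℕ) [NeZero N], 3 ≤ N → ∀ (F : T4Family) (θ : Node00.Stage12Params F N) (h : θ.Provisos₁₂ F N),
      (θ.ZtUnity F N ∧ θ.SlotsNondegenerate) → θ.Admissible F N → B16.EndStatementBPrinted (Node00.datumOfRecord₁₂ F N θ h).C →
      DagBinding.EndpointExistence (Node00.datumOfRecord₁₂ F N θ h).C.toB12 →
      T4ApexHybrid.HybridNE7Under (Node00.datumOfRecord₁₂ F N θ h) (DagBinding.EndpointExistence (Node00.datumOfRecord₁₂ F N θ h).C.toB12)) :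
    ∀ (N : ℕ) [NeZero N], 3 ≤ N → YMDAG.UVSplit.UVD59 N :=
  fun N _ hN => uvD59_of_theta15Chain (h0 N hN) (h1 N hN) (h2 N hN) (h3 N hN)

/-- **`UVSUN` from the rev-15 chain for every `N ≥ 2`** (its `N = 2` instance is the spine's `UV`, `uv_of_uvSUN`). -/
theorem uvSUN_of_theta15Chain
    (h0 : ∀ (N : ℕ) [NeZero N], 2 ≤ N → ∀ F : T4Family,
      ∃ θ : Node00.Stage12Params F N, θ.Provisos₁₂ F N ∧ (θ.ZtUnity F N ∧ θ.SlotsNondegenerate) ∧ θ.Admissible F N)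
    (h1 : ∀ (N : ℕ) [NeZero N], 2 ≤ N → ∀ F : T4Family,
      (∃ θ : Node00.Stage12Params F N, θ.Provisos₁₂ F N ∧ (θ.ZtUnity F N ∧ θ.SlotsNondegenerate) ∧ θ.Admissible F N) →
      ∃ (θ : Node00.Stage12Params F N) (h : θ.Provisos₁₂ F N), (θ.ZtUnity F N ∧ θ.SlotsNondegenerate) ∧ θ.Admissible F N ∧
        B16.EndStatementBPrinted (Node00.datumOfRecord₁₂ F N θ h).C ∧ ∃ γ₁ : ℝ, 0 < γ₁ ∧ ∀ γ : ℝ, 0 < γ → γ ≤ γ₁ →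
          ∃ P : B12.RunParams, 1 ≤ P.K ∧ ((Node00.datumOfRecord₁₂ F N θ h).C P).flow.InInterval γ P.K)
    (h2 : ∀ (N : ℕ) [NeZero N], 2 ≤ N → ∀ (F : T4Family) (θ : Node00.Stage12Params F N) (h : θ.Provisos₁₂ F N),
      (θ.ZtUnity F N ∧ θ.SlotsNondegenerate) → θ.Admissible F N → B16.EndStatementBPrinted (Node00.datumOfRecord₁₂ F N θ h).C →
      (∃ γ₁ : ℝ, 0 < γ₁ ∧ ∀ γ : ℝ, 0 < γ → γ ≤ γ₁ →
        ∃ P : B12.RunParams, 1 ≤ P.K ∧ ((Node00.datumOfRecord₁₂ F N θ h).C P).flow.InInterval γ P.K) →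
      DagBinding.EndpointExistence (Node00.datumOfRecord₁₂ F N θ h).C.toB12)
    (h3 : ∀ (N : ℕ) [NeZero N], 2 ≤ N → ∀ (F : T4Family) (θ : Node00.Stage12Params F N) (h : θ.Provisos₁₂ F N),
      (θ.ZtUnity F N ∧ θ.SlotsNondegenerate) → θ.Admissible F N → B16.EndStatementBPrinted (Node00.datumOfRecord₁₂ F N θ h).C →
      DagBinding.EndpointExistence (Node00.datumOfRecord₁₂ F N θ h).C.toB12 →
      T4ApexHybrid.HybridNE7Under (Node00.datumOfRecord₁₂ F N θ h) (DagBinding.EndpointExistence (Node00.datumOfRecord₁₂ F N θ h).C.toB12)) :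
    UVSUN :=
  fun N _ hN => uvD59_of_theta15Chain (h0 N hN) (h1 N hN) (h2 N hN) (h3 N hN)

end Summit.QuantumFields.YangMills.Theorems.UVOtherGroups

end
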